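import Summits.AtomisticToContinuum.Crystallization.Theorems.PalmUnimodularRigidityLayeredLawsSelectHcpTubeMuGSC
import Summits.AtomisticToContinuum.Crystallization.Theorems.PalmUnimodularRigidityLayeredLawsSelectHcpForceBalance
import Summits.AtomisticToContinuum.Crystallization.Theorems.LayeredLawsSelectHcp.Negative.FccModel

/-!
# Crux `LayeredLawsSelectHcp` (stmt-AtomisticToContinuum-9226), line `mtp-prestress-split-ergodic-frame`:
# minimising layered laws are almost surely in force balance at every point

Registered sub-goal `tube_ae_forceBalance` (glue of the two landed supports `tube_ae_isMuGSC` and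
`tube_muGSC_forceBalance`): for every minimising (`E_P[h] ≤ e*`) point-stationary LAYERED probability law,
almost every sample `count|S` is a Lennard-Jones EQUILIBRIUM configuration — at every `p ∈ S` the total force
`Σ_{q ≠ p} V′(|p − q|)(p − q)/|p − q|` has sum `0` — the deterministic first-order input of the Liouville route to
`stub_tubeZeroDefect`.  [folklore]
-/

noncomputable section

open MeasureTheory

namespace Summit.AtomisticToContinuum.Crystallization.Theorems.PalmUnimodularRigidity.LayeredLawsSelectHcp

open Literature.Probability.Process (IsRootedHardCore)
open Literature.MathematicalPhysics.StatisticalMechanics (lennardJones IsMuGSC)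
open Summit.AtomisticToContinuum.Crystallization.Theorems.ChargedEnergyGapNegative (eStar)
open Summit.AtomisticToContinuum.Crystallization.Theorems.LayeredLawsSelectHcp.Negative.DiracLaws
  (PointStationary meanRootEnergy Layered)
open Summit.AtomisticToContinuum.Crystallization.Theorems.LayeredLawsSelectHcp.Negative.FccModel
  (set_eq_of_count_restrict_eq)

/-- Euclidean `3`-space. [folklore] -/
local notation "E3" => EuclideanSpace ℝ (Fin 3)

/-- **Registered sub-goal `tube_ae_forceBalance`.**  Almost every sample of a minimising point-stationary layered
probability law is a hard-core Lennard-Jones equilibrium configuration. [folklore] -/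
theorem tube_ae_forceBalance :
    ∀ P : Measure (Measure E3), IsProbabilityMeasure P → PointStationary P → meanRootEnergy P ≤ eStar →
      Layered P → ∀ᵐ μ ∂P, ∃ S : Set E3, μ = (Measure.count : Measure E3).restrict S ∧
        (∀ x ∈ S, ∀ y ∈ S, x ≠ y → (891 / 1000 : ℝ) ≤ dist x y) ∧
        ∀ p ∈ S, HasSum (fun q : {q : E3 // q ∈ S ∧ q ≠ p} =>
          (deriv lennardJones (dist p q.1) / dist p q.1) • (p - q.1)) 0 := by
  intro P hP h2 h3 h4
  filter_upwards [ae_isRootedHardCore_of_layered h2 h4, tube_ae_isMuGSC P hP h2 h3 h4] with μ hcore hgsc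
  obtain ⟨S, -, hsep, hμS⟩ := hcore
  obtain ⟨S', hμS', hS'⟩ := hgsc
  have hSS' : S' = S := set_eq_of_count_restrict_eq (hμS'.symm.trans hμS)
  rw [← hSS'] at hsep
  exact ⟨S', hμS', hsep, fun p hp =>
    tube_muGSC_forceBalance (891 / 1000) eStar (by norm_num) S' hsep hS' p hp⟩

end Summit.AtomisticToContinuum.Crystallization.Theorems.PalmUnimodularRigidity.LayeredLawsSelectHcp

end
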